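import Mathlib
import Summits.Ventures.HodgeRepro0.CMCombinatorics

/-!
# Distinct sign characters ⇒ nondegenerate CM type data (cell pub-hodge-repro0, seat p8)

Combinatorial core of statement (C6) of `proofs/p8-C6-sign-characters.md` (and of Case B in the
proof of (C5) of `proofs/p8-lefschetz-analysis.md`).

Setting: `X` a finite set with a fixed-point-free involution `ι`, a finite group `N` acting on `X`
commuting with `ι` and preserving every pair `{x, ι x}` (think: `N = Gal(K^c/L)`, `L` the Galois
closure of the maximal totally real subfield `K⁺`).  Each `n ∈ N` acts on the pair of `x` by the
identity or the swap; `sgn n x = ±1` records which.  If the sign characters `n ↦ sgn n x` of the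
pairs are pairwise distinct, then for EVERY CM type `Φ` (an `ι`-transversal) the data
`CMTypeData.ofCMType ι … Φ …` with CM types `n • Φ` is nondegenerate in the sense of
`CMTypeData.Nondegenerate`; by `CMTypeData.Nondegenerate.mono` this persists for any larger family of
CM types (e.g. the translates under the full Galois group), and then
`CMTypeData.pairDecomposable_of_isHodgeSet_of_nondegenerate` applies.

Proof: the anti-invariant functions are spanned by the vectors `e_x = δ_x − δ_{ι x}`; the vector
`f_n = 1_{nΦ} − 1_{ι nΦ}` equals `Σ_{z ∈ Φ} sgn n z • e_z`; the "projector" `Σ_n sgn n x • f_n`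
equals `± |N| • e_x` by orthogonality of distinct `±1`-valued characters.
-/

namespace HodgeRepro0.CMCombinatorics

open Finset
open scoped Pointwise

variable {X : Type*} [Fintype X] [DecidableEq X]

/-- The anti-invariant vector `e_x = δ_x − δ_{ι x}`. -/
def evec (ι : X → X) (x : X) : X → ℚ :=
  fun y => (if y = x then 1 else 0) - (if y = ι x then 1 else 0)

omit [Fintype X] in
/-- `e_{ι x} = − e_x`. -/
lemma evec_iota (ι : X → X) (hι : ∀ x, ι (ι x) = x) (x : X) : evec ι (ι x) = - evec ι x := by
  funext y
  simp only [evec, hι, Pi.neg_apply]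
  ring

/-- Every `ι`-anti-invariant function is `½ Σ_x h x • e_x`. -/
lemma anti_eq_sum_evec (ι : X → X) (hι : ∀ x, ι (ι x) = x) (h : X → ℚ)
    (hh : ∀ x, h (ι x) = - h x) :
    h = (1 / 2 : ℚ) • ∑ x, h x • evec ι x := by
  funext y
  simp only [Pi.smul_apply, Finset.sum_apply, smul_eq_mul, evec, mul_sub, Finset.sum_sub_distrib,
    mul_ite, mul_one, mul_zero]
  have e1 : (∑ x, if y = x then h x else 0) = h y := by simp
  have e2 : (∑ x, if y = ι x then h x else 0) = h (ι y) := by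
    rw [Fintype.sum_equiv (Function.Involutive.toPerm ι hι) (fun x => if y = ι x then h x else 0)
      (fun x => if y = x then h (ι x) else 0) (fun x => by simp [Function.Involutive.coe_toPerm, hι])]
    simp
  rw [e1, e2, hh]
  ring

section SignCharacters

variable {N : Type*} [Group N] [Fintype N] [MulAction N X]

/-- The sign of `n` at `x`: `1` if `n` fixes `x`, `-1` otherwise.  When `n` preserves the pair
`{x, ι x}` this is the sign character of the pair evaluated at `n`. -/
def sgn (n : N) (x : X) : ℚ := if n • x = x then 1 else -1

omit [Fintype X] [Fintype N] in
/-- The sign character of a pair does not depend on the chosen element of the pair. -/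
lemma sgn_iota (ι : X → X) (hι : ∀ x, ι (ι x) = x)
    (hcomm : ∀ (n : N) (x : X), n • ι x = ι (n • x)) (n : N) (x : X) :
    sgn n (ι x) = sgn n x := by
  unfold sgn
  rw [hcomm]
  have key : ι (n • x) = ι x ↔ n • x = x :=
    ⟨fun h => by rw [← hι (n • x), h, hι], fun h => by rw [h]⟩
  split_ifs with h1 h2 h2
  · rfl
  · exact absurd (key.1 h1) h2
  · exact absurd (key.2 h2) h1
  · rfl

omit [Fintype X] [Fintype N] in
/-- Multiplicativity of the sign character. -/
lemma sgn_mul (ι : X → X) (hι : ∀ x, ι (ι x) = x) (hne : ∀ x, ι x ≠ x)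
    (hpair : ∀ (n : N) (x : X), n • x = x ∨ n • x = ι x)
    (hcomm : ∀ (n : N) (x : X), n • ι x = ι (n • x)) (n m : N) (x : X) :
    sgn (n * m) x = sgn n x * sgn m x := by
  unfold sgn
  rw [mul_smul]
  rcases hpair m x with hm | hm
  · rw [hm]
    simp
  · rw [hm, hcomm, if_neg (hne x)]
    rcases hpair n x with hn | hn
    · rw [hn, if_pos rfl, if_neg (hne x)]
      norm_num
    · rw [hn, hι, if_pos rfl, if_neg (hne x)]
      norm_num

omit [Fintype X] in
/-- Orthogonality: if the product character `sgn · x · sgn · z` takes the value `-1` somewhere, it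
sums to `0` over `N`. -/
lemma sum_sgn_mul_sgn_eq_zero (ι : X → X) (hι : ∀ x, ι (ι x) = x) (hne : ∀ x, ι x ≠ x)
    (hpair : ∀ (n : N) (x : X), n • x = x ∨ n • x = ι x)
    (hcomm : ∀ (n : N) (x : X), n • ι x = ι (n • x)) (x z : X) (n₀ : N)
    (h₀ : sgn n₀ x * sgn n₀ z = -1) :
    ∑ n : N, sgn n x * sgn n z = 0 := by
  have hre : ∑ n : N, sgn n x * sgn n z = ∑ n : N, sgn (n₀ * n) x * sgn (n₀ * n) z :=
    (Fintype.sum_equiv (Equiv.mulLeft n₀) _ _ (fun n => rfl)).symm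
  have hneg : ∑ n : N, sgn (n₀ * n) x * sgn (n₀ * n) z = - ∑ n : N, sgn n x * sgn n z := by
    rw [← Finset.sum_neg_distrib]
    refine Finset.sum_congr rfl fun n _ => ?_
    rw [sgn_mul ι hι hne hpair hcomm, sgn_mul ι hι hne hpair hcomm]
    calc sgn n₀ x * sgn n x * (sgn n₀ z * sgn n z)
        = (sgn n₀ x * sgn n₀ z) * (sgn n x * sgn n z) := by ring
      _ = -(sgn n x * sgn n z) := by rw [h₀]; ring
  linarith

omit [Fintype X] in
/-- `Σ_n sgn n x · sgn n z = |N|` if the sign characters of `x` and `z` agree, and `0` otherwise. -/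
lemma sum_sgn_mul_sgn (ι : X → X) (hι : ∀ x, ι (ι x) = x) (hne : ∀ x, ι x ≠ x)
    (hpair : ∀ (n : N) (x : X), n • x = x ∨ n • x = ι x)
    (hcomm : ∀ (n : N) (x : X), n • ι x = ι (n • x)) (x z : X) :
    ∑ n : N, sgn n x * sgn n z
      = if (∀ n : N, sgn n x = sgn n z) then (Fintype.card N : ℚ) else 0 := by
  split_ifs with h
  · have h1 : ∀ n : N, sgn n x * sgn n z = 1 := fun n => by
      rw [h n]
      unfold sgn
      split_ifs <;> norm_num
    simp [h1]
  · simp only [not_forall] at h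
    obtain ⟨n₀, hn₀⟩ := h
    apply sum_sgn_mul_sgn_eq_zero ι hι hne hpair hcomm x z n₀
    unfold sgn at hn₀ ⊢
    split_ifs at hn₀ ⊢ <;> first | exact absurd rfl hn₀ | norm_num

omit [Fintype X] [Fintype N] in
/-- `e_{n • z} = sgn n z • e_z`. -/
lemma evec_smul (ι : X → X) (hι : ∀ x, ι (ι x) = x) (hne : ∀ x, ι x ≠ x)
    (hpair : ∀ (n : N) (x : X), n • x = x ∨ n • x = ι x) (n : N) (z : X) :
    evec ι (n • z) = sgn n z • evec ι z := by
  unfold sgn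
  rcases hpair n z with h | h
  · rw [if_pos h, h, one_smul]
  · rw [if_neg (fun hz => hne z (h ▸ hz)), h, evec_iota ι hι, neg_one_smul]

omit [Fintype X] [Fintype N] in
/-- `f_n = 1_{nΦ} − 1_{ι nΦ} = Σ_{z ∈ Φ} e_{n • z}`. -/
lemma fvec_ofCMType_eq (ι : X → X) (hι : ∀ x, ι (ι x) = x) (hne : ∀ x, ι x ≠ x)
    (hcomm : ∀ (n : N) (x : X), n • ι x = ι (n • x)) (Φ : Finset X)
    (hΦ : ∀ x, x ∈ Φ ↔ ι x ∉ Φ) (n : N) :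
    (CMTypeData.ofCMType ι hι hne hcomm Φ hΦ).fvec n = ∑ z ∈ Φ, evec ι (n • z) := by
  funext y
  simp only [CMTypeData.fvec, CMTypeData.ofCMType, evec, Finset.sum_apply, Finset.sum_sub_distrib]
  congr 1
  · have e : ∀ z, (y = n • z) ↔ (n⁻¹ • y = z) := fun z => inv_smul_eq_iff.symm
    simp only [e, Finset.sum_ite_eq, Finset.inv_smul_mem_iff]
    split_ifs <;> rfl
  · have e : ∀ z, (y = ι (n • z)) ↔ (n⁻¹ • ι y = z) := fun z => by
      rw [inv_smul_eq_iff]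
      constructor
      · intro h
        rw [h, hι]
      · intro h
        rw [← h, hι]
    simp only [e, Finset.sum_ite_eq, Finset.inv_smul_mem_iff]
    split_ifs <;> rfl

omit [Fintype X] in
/-- The projector identity `Σ_n sgn n x • f_n = Σ_{z ∈ Φ} (Σ_n sgn n x · sgn n z) • e_z`. -/
lemma sum_sgn_smul_fvec (ι : X → X) (hι : ∀ x, ι (ι x) = x) (hne : ∀ x, ι x ≠ x)
    (hpair : ∀ (n : N) (x : X), n • x = x ∨ n • x = ι x)
    (hcomm : ∀ (n : N) (x : X), n • ι x = ι (n • x)) (Φ : Finset X)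
    (hΦ : ∀ x, x ∈ Φ ↔ ι x ∉ Φ) (x : X) :
    ∑ n : N, sgn n x • (CMTypeData.ofCMType ι hι hne hcomm Φ hΦ).fvec n
      = ∑ z ∈ Φ, (∑ n : N, sgn n x * sgn n z) • evec ι z := by
  simp only [fvec_ofCMType_eq ι hι hne hcomm Φ hΦ, evec_smul ι hι hne hpair, Finset.smul_sum,
    smul_smul, Finset.sum_smul]
  rw [Finset.sum_comm]

omit [Fintype X] in
/-- If the sign characters are pairwise distinct, every `e_x` lies in the span of the `f_n`. -/
theorem evec_mem_span (ι : X → X) (hι : ∀ x, ι (ι x) = x) (hne : ∀ x, ι x ≠ x)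
    (hpair : ∀ (n : N) (x : X), n • x = x ∨ n • x = ι x)
    (hcomm : ∀ (n : N) (x : X), n • ι x = ι (n • x)) (Φ : Finset X)
    (hΦ : ∀ x, x ∈ Φ ↔ ι x ∉ Φ)
    (hdist : ∀ x y : X, (∀ n : N, sgn n x = sgn n y) → y = x ∨ y = ι x) (x : X) :
    evec ι x ∈ Submodule.span ℚ (Set.range (CMTypeData.ofCMType ι hι hne hcomm Φ hΦ).fvec) := by
  have hmem : ∑ n : N, sgn n x • (CMTypeData.ofCMType ι hι hne hcomm Φ hΦ).fvec n
      ∈ Submodule.span ℚ (Set.range (CMTypeData.ofCMType ι hι hne hcomm Φ hΦ).fvec) :=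
    Submodule.sum_mem _ fun n _ => Submodule.smul_mem _ _ (Submodule.subset_span ⟨n, rfl⟩)
  rw [sum_sgn_smul_fvec ι hι hne hpair hcomm Φ hΦ x] at hmem
  have hcond : ∀ z, (∀ n : N, sgn n x = sgn n z) ↔ (z = x ∨ z = ι x) := fun z =>
    ⟨hdist x z, by
      rintro (rfl | rfl)
      · exact fun n => rfl
      · exact fun n => (sgn_iota ι hι hcomm n x).symm⟩
  simp only [sum_sgn_mul_sgn ι hι hne hpair hcomm, hcond] at hmem
  set c : ℚ := if x ∈ Φ then (Fintype.card N : ℚ) else -(Fintype.card N : ℚ) with hc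
  have hcollapse : ∑ z ∈ Φ,
      (if z = x ∨ z = ι x then (Fintype.card N : ℚ) else 0) • evec ι z = c • evec ι x := by
    by_cases hx : x ∈ Φ
    · rw [Finset.sum_eq_single x]
      · simp [hc, hx]
      · intro b hb hbx
        have hb' : b ≠ ι x := fun h => (hΦ x).1 hx (h ▸ hb)
        simp [hbx, hb']
      · intro h
        exact absurd hx h
    · have hix : ι x ∈ Φ := by
        by_contra h
        exact hx ((hΦ x).2 h)
      rw [Finset.sum_eq_single (ι x)]
      · simp [hc, hx, evec_iota ι hι]
      · intro b hb hbx
        have hb' : b ≠ x := fun h => hx (h ▸ hb)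
        simp [hbx, hb']
      · intro h
        exact absurd hix h
  rw [hcollapse] at hmem
  have hc0 : c ≠ 0 := by
    have : (Fintype.card N : ℚ) ≠ 0 := by exact_mod_cast Fintype.card_ne_zero
    rw [hc]
    split_ifs <;> simp
  have := Submodule.smul_mem _ c⁻¹ hmem
  rwa [smul_smul, inv_mul_cancel₀ hc0, one_smul] at this

/-- **Distinct sign characters ⇒ nondegenerate** (combinatorial core of (C6)): if the sign
characters of the pairs are pairwise distinct, the CM-type data with CM types `n • Φ`, `n ∈ N`, is
nondegenerate for every CM type `Φ`. -/
theorem nondegenerate_of_distinct_sgn (ι : X → X) (hι : ∀ x, ι (ι x) = x) (hne : ∀ x, ι x ≠ x)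
    (hpair : ∀ (n : N) (x : X), n • x = x ∨ n • x = ι x)
    (hcomm : ∀ (n : N) (x : X), n • ι x = ι (n • x)) (Φ : Finset X)
    (hΦ : ∀ x, x ∈ Φ ↔ ι x ∉ Φ)
    (hdist : ∀ x y : X, (∀ n : N, sgn n x = sgn n y) → y = x ∨ y = ι x) :
    (CMTypeData.ofCMType ι hι hne hcomm Φ hΦ).Nondegenerate := by
  intro h hh
  have hh' : ∀ x, h (ι x) = - h x := hh
  rw [anti_eq_sum_evec ι hι h hh']
  exact Submodule.smul_mem _ _ (Submodule.sum_mem _ fun x _ =>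
    Submodule.smul_mem _ _ (evec_mem_span ι hι hne hpair hcomm Φ hΦ hdist x))

end SignCharacters

omit [Fintype X] in
/-- Nondegeneracy only grows with the family of CM types. -/
lemma CMTypeData.Nondegenerate.mono {Γ Γ' : Type*} {D : CMTypeData X Γ} {D' : CMTypeData X Γ'}
    (hι : D'.ι = D.ι) (hT : ∀ γ, ∃ γ', D'.T γ' = D.T γ) (hD : D.Nondegenerate) :
    D'.Nondegenerate := by
  intro h hh
  have hh' : ∀ x, h (D.ι x) = - h x := fun x => by rw [← hι]; exact hh x
  refine Submodule.span_mono ?_ (hD h hh')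
  rintro _ ⟨γ, rfl⟩
  obtain ⟨γ', hγ'⟩ := hT γ
  refine ⟨γ', ?_⟩
  funext x
  simp only [CMTypeData.fvec, hγ', hι]

/-- **(C6), group form.**  Let `G` act on `X` commuting with `ι` (the Galois group), and let `N`
be a group acting on `X` through elements of `G`, preserving every pair, with pairwise distinct
sign characters.  Then the CM-type data of the `G`-translates of any CM type `Φ` is nondegenerate,
hence every Hodge set is pair-decomposable. -/
theorem nondegenerate_of_distinct_sgn_of_le {G : Type*} [Group G] [MulAction G X]
    (ι : X → X) (hι : ∀ x, ι (ι x) = x) (hne : ∀ x, ι x ≠ x)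
    (hcommG : ∀ (g : G) (x : X), g • ι x = ι (g • x))
    {N : Type*} [Group N] [Fintype N] [MulAction N X]
    (hpair : ∀ (n : N) (x : X), n • x = x ∨ n • x = ι x)
    (hcommN : ∀ (n : N) (x : X), n • ι x = ι (n • x))
    (hsub : ∀ n : N, ∃ g : G, ∀ x : X, n • x = g • x)
    (hdist : ∀ x y : X, (∀ n : N, sgn n x = sgn n y) → y = x ∨ y = ι x)
    (Φ : Finset X) (hΦ : ∀ x, x ∈ Φ ↔ ι x ∉ Φ) :
    (CMTypeData.ofCMType ι hι hne hcommG Φ hΦ).Nondegenerate := by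
  refine CMTypeData.Nondegenerate.mono (D := CMTypeData.ofCMType ι hι hne hcommN Φ hΦ)
    (D' := CMTypeData.ofCMType ι hι hne hcommG Φ hΦ) rfl (fun n => ?_)
    (nondegenerate_of_distinct_sgn ι hι hne hpair hcommN Φ hΦ hdist)
  obtain ⟨g, hg⟩ := hsub n
  refine ⟨g, ?_⟩
  ext y
  simp only [CMTypeData.ofCMType, Finset.mem_smul_finset, hg]

end HodgeRepro0.CMCombinatorics
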